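import Summits.AtomisticToContinuum.BoseEinsteinCondensation.Theorems.BECThomsonPrincipleGDTransferSeededCompactDefs

/-!
# Route `BECThomsonPrinciple`, crux `GDTransfer` (stmt-AtomisticToContinuum-9482), line `seeded-continuity`
# (skeleton v8) — registered stub `stub_localConstancyL1`: local constancy of the law of near-minimisers in the
# side, for admissible profiles FINITE ON `[0, ∞)` WITH INTEGRABLE LIFT, by the compactness transport (D)

Supports (does not close) stmt-AtomisticToContinuum-9482.

**Statement** (`Sig.stub_localConstancyL1 = DilateCompactL1 → NearMinPhaseInt → CountLaw → ∀ v,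
IsRepulsiveFiniteRange v → (∀ r ≥ 0, v r ≠ ⊤) → ∫_{ℝ³} v(|x|) dx < ∞ → LocalConstancy v`).  At fixed particle
number `N = m + 1` and every side `L₁ > 0` the periodic ground-state energy is finite, and for every `ε > 0`
there are a radius `r > 0` and a slack `δ₁ > 0` such that for every side `L'` with `|L' − L₁| < r` some slack
`δ' > 0` makes the condensed-side mass `hiMass = P(n̂₀ ≥ (1−β)N)` of every `δ'`-near-minimiser at `L'` and of
every `δ₁`-near-minimiser at `L₁` agree within `ε` — GIVEN the compactness transport `DilateCompactL1` (D), the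
near-minimiser phase stability `NearMinPhaseInt` and `CountLaw` (all HYPOTHESES here).

**Proof** (c3's `stub_localConstancyInt`, p159668's input, with the Sobolev transport replaced by (D)).
* `E₀(v, N, L₁) < ∞` and, for `η > 0`, a slack `δ₁` making any two `δ₁`-near-minimisers of `v` at `(N, L₁)`
  `η`-close in `L²(cell^N)` up to a phase: the two halves of `NearMinPhaseInt` (fed with the `L¹` lift).
* (D) at `(N, L₁)` with tolerance `η` and target slack `δ₁` gives `ϑ > 0` and a slack `δ'_D > 0`.
* For `|L' − L₁| < r = min(L₁/2, ϑL₁/2)` put `b = L₁/L'` (`|b − 1| < ϑ`) and the slack `δ' = b²δ'_D` at `L'`.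
  Dilate a `δ'`-near-minimiser `Ψ'` at `L'` to `Φ = Ψ'_b` at side `L₁`: same law (`hiMass_dilate`) and
  `E_{b⁻²v(·/b)}(Φ) = b⁻²E_v(Ψ') ≤ E₀(b⁻²v(·/b), N, L₁) + δ'_D` (`periodicEnergy_dilate`,
  `periodicGroundStateEnergy_scaledPotential`), so (D) puts a `δ₁`-near-minimiser `Θ` of `v` within `η` of `Φ`;
  phase stability aligns `Θ` with `cΨ₁` within `η`; hence `∫|Φ − cΨ₁|² ≤ (2η)²`
  (`|a + b|² ≤ 2|a|² + 2|b|²`).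
* `CountLaw` (2) both ways between `Φ` and `cΨ₁` (the law of `cΨ₁` is that of `Ψ₁`, `compMass_phase_mul`;
  masses `≤ 1` by `CountLaw` (1)) gives `|hiMass Φ − hiMass Ψ₁| ≤ 2(2η) + (2η)² ≤ ε` for `η = min(ε/16, 1/2)`.

## References

* [LSSY2005] E. H. Lieb, R. Seiringer, J. P. Solovej, J. Yngvason, *The Mathematics of the Bose Gas and
  its Condensation*, Birkhäuser (2005): Ch. 5, footnote to (5.3) (scaling of the torus problem); §1.2 (1.16),
  Ch. 2 (2.1) (the admissible class: measurable, finite range).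
* [Fournais2020] S. Fournais, *Length scales for BEC in the dilute Bose gas*, Assumption 1.1 (integrable
  profiles).
-/

noncomputable section

open MeasureTheory Filter Set Metric
open scoped ENNReal NNReal

namespace Summit.AtomisticToContinuum.BoseEinsteinCondensation.Cruxes.GDTransfer.Seeded

open Literature.MathematicalPhysics.QuantumManyBody.BoseGas
open Literature.Barriers.AtomisticToContinuum.BoseGas (scaledPotential periodicEnergy_dilate
  periodicGroundStateEnergy_scaledPotential)

/-! ## An `L²` two-step estimate -/

/-- **Two `η`-steps in `L²` make a `2η`-step**: if `∫|f − g|² ≤ η²` and `∫|g − h|² ≤ η²` then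
`∫|f − h|² ≤ (2η)²` (pointwise `|a + b|² ≤ 2|a|² + 2|b|²`, no Minkowski needed). [folklore] -/
private theorem lintegral_nnnorm_sub_sq_le_of_le_of_le {α : Type*} [MeasurableSpace α] {μ : Measure α}
    {f g h : α → ℂ} (hf : Measurable f) (hg : Measurable g) {η : ℝ}
    (h₁ : ∫⁻ x, (‖f x - g x‖₊ : ℝ≥0∞) ^ 2 ∂μ ≤ ENNReal.ofReal (η ^ 2))
    (h₂ : ∫⁻ x, (‖g x - h x‖₊ : ℝ≥0∞) ^ 2 ∂μ ≤ ENNReal.ofReal (η ^ 2)) :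
    ∫⁻ x, (‖f x - h x‖₊ : ℝ≥0∞) ^ 2 ∂μ ≤ ENNReal.ofReal ((2 * η) ^ 2) := by
  -- pointwise: `|f − h|² ≤ (|f − g| + |g − h|)² ≤ 2|f − g|² + 2|g − h|²`
  have hsq : ∀ a b : ℝ≥0, (((a + b : ℝ≥0)) : ℝ≥0∞) ^ 2 ≤ 2 * (a : ℝ≥0∞) ^ 2 + 2 * (b : ℝ≥0∞) ^ 2 := by
    intro a b
    have h : (a + b) ^ 2 ≤ 2 * a ^ 2 + 2 * b ^ 2 := by
      rw [← NNReal.coe_le_coe]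
      push_cast
      nlinarith [sq_nonneg ((a : ℝ) - b)]
    exact_mod_cast h
  have hpt : ∀ x, (‖f x - h x‖₊ : ℝ≥0∞) ^ 2 ≤
      2 * (‖f x - g x‖₊ : ℝ≥0∞) ^ 2 + 2 * (‖g x - h x‖₊ : ℝ≥0∞) ^ 2 := fun x => by
    have htri : (‖f x - h x‖₊ : ℝ≥0∞) ≤ ((‖f x - g x‖₊ + ‖g x - h x‖₊ : ℝ≥0) : ℝ≥0∞) := by
      have hx : f x - h x = (f x - g x) + (g x - h x) := by ring
      rw [hx]
      exact_mod_cast nnnorm_add_le _ _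
    exact (pow_le_pow_left' htri 2).trans (hsq _ _)
  have hmeas : Measurable fun x => 2 * (‖f x - g x‖₊ : ℝ≥0∞) ^ 2 :=
    ((hf.sub hg).nnnorm.coe_nnreal_ennreal.pow_const 2).const_mul 2
  calc ∫⁻ x, (‖f x - h x‖₊ : ℝ≥0∞) ^ 2 ∂μ
      ≤ ∫⁻ x, 2 * (‖f x - g x‖₊ : ℝ≥0∞) ^ 2 + 2 * (‖g x - h x‖₊ : ℝ≥0∞) ^ 2 ∂μ := lintegral_mono hpt
    _ = 2 * ∫⁻ x, (‖f x - g x‖₊ : ℝ≥0∞) ^ 2 ∂μ + 2 * ∫⁻ x, (‖g x - h x‖₊ : ℝ≥0∞) ^ 2 ∂μ := by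
        rw [lintegral_add_left hmeas, lintegral_const_mul' _ _ ENNReal.ofNat_ne_top,
          lintegral_const_mul' _ _ ENNReal.ofNat_ne_top]
    _ ≤ 2 * ENNReal.ofReal (η ^ 2) + 2 * ENNReal.ofReal (η ^ 2) := by gcongr
    _ = ENNReal.ofReal ((2 * η) ^ 2) := by
        rw [← ENNReal.ofReal_ofNat 2, ← ENNReal.ofReal_mul zero_le_two,
          ← ENNReal.ofReal_add (by positivity) (by positivity)]
        congr 1
        ring

/-! ## Law comparison at fixed `(N, L)` from `L²`-closeness up to a phase -/

/-- **The law of a state `L²`-close to a phase multiple of another is close** (fixed `(N, L)`, given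
`CountLaw`): if `∫_{cell^N}|Θ − cΞ|² ≤ η²` with `|c| = 1` then every partial mass satisfies
`P_Θ(n̂₀ ∈ A) ≤ P_Ξ(n̂₀ ∈ A) + 2η + η²` and `P_Ξ(n̂₀ ∈ A) ≤ P_Θ(n̂₀ ∈ A) + 2η + η²` (`CountLaw` (2) both ways;
the law of `cΞ` is that of `Ξ`, `compMass_phase_mul`). [folklore] -/
private theorem lawMass_close_of_sqClose (hC : CountLaw) (m : ℕ) {L : ℝ} (hL : 0 < L)
    (p : ℕ → Prop) [DecidablePred p] (Θ Ξ : PeriodicTrialState (m + 1) L) {c : ℂ} (hc : ‖c‖ = 1)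
    {η : ℝ} (hη : 0 < η)
    (hclose : ∫⁻ X in cellN (m + 1) L, (‖Θ.ψ X - c * Ξ.ψ X‖₊ : ℝ≥0∞) ^ 2 ≤ ENNReal.ofReal (η ^ 2)) :
    lawMass m L p Θ.ψ ≤ lawMass m L p Ξ.ψ + ENNReal.ofReal (2 * η + η ^ 2) ∧
      lawMass m L p Ξ.ψ ≤ lawMass m L p Θ.ψ + ENNReal.ofReal (2 * η + η ^ 2) := by
  -- adapted from `lawMass_le_of_phaseClose` (…GDTransferSeededLocalConstancyInt.lean)
  have hcn : ((‖c‖₊ : ℝ≥0) : ℝ≥0∞) = 1 := by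
    rw [← ENNReal.coe_one, ENNReal.coe_inj, ← NNReal.coe_inj, coe_nnnorm, hc, NNReal.coe_one]
  have hcontg : Continuous fun X => c * Ξ.ψ X := continuous_const.mul Ξ.contDiff.continuous
  have hg1 : ∫⁻ X in cellN (m + 1) L, (‖c * Ξ.ψ X‖₊ : ℝ≥0∞) ^ 2 ≤ 1 := by
    have hX : ∀ X, (‖c * Ξ.ψ X‖₊ : ℝ≥0∞) ^ 2 = (‖Ξ.ψ X‖₊ : ℝ≥0∞) ^ 2 := fun X => by
      rw [nnnorm_mul, ENNReal.coe_mul, mul_pow, hcn, one_pow, one_mul]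
    simp only [hX]
    rw [Ξ.norm_eq]
  have hf1 : ∫⁻ X in cellN (m + 1) L, (‖Θ.ψ X‖₊ : ℝ≥0∞) ^ 2 ≤ 1 := Θ.norm_eq.le
  have hclose' : ∫⁻ X in cellN (m + 1) L, (‖c * Ξ.ψ X - Θ.ψ X‖₊ : ℝ≥0∞) ^ 2 ≤
      ENNReal.ofReal (η ^ 2) := by
    have hX : ∀ X, ‖c * Ξ.ψ X - Θ.ψ X‖₊ = ‖Θ.ψ X - c * Ξ.ψ X‖₊ := fun X => by
      rw [← neg_sub, nnnorm_neg]
    simp only [hX]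
    exact hclose
  have hphase : ∀ S : Finset (Fin (m + 1)), compMass m L S (fun X => c * Ξ.ψ X) = compMass m L S Ξ.ψ :=
    fun S => compMass_phase_mul m L S hc Ξ.ψ
  set T : Finset (Finset (Fin (m + 1))) := (Finset.univ : Finset (Finset (Fin (m + 1)))).filter
    fun S => p S.card with hT
  have h₁ := hC.2 m L hL T Θ.ψ (fun X => c * Ξ.ψ X) Θ.contDiff.continuous hcontg hg1 η hη hclose
  have h₂ := hC.2 m L hL T (fun X => c * Ξ.ψ X) Θ.ψ hcontg Θ.contDiff.continuous hf1 η hη hclose'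
  simp only [hphase] at h₁ h₂
  exact ⟨h₁, h₂⟩

/-- **The condensed-side masses are close, in `ℝ`, from `L²`-closeness up to a phase** (fixed `(N, L)`, given
`CountLaw`): if `∫_{cell^N}|Θ − cΞ|² ≤ η²`, `|c| = 1`, and `2η + η² ≤ ε`, then `hiMass Θ` and `hiMass Ξ` agree
within `ε` as real numbers (the masses are `≤ 1 < ∞` by `CountLaw` (1)). [folklore] -/
private theorem hiMass_toReal_close_of_sqClose (hC : CountLaw) (m : ℕ) {L : ℝ} (hL : 0 < L) (β : ℝ)
    (Θ Ξ : PeriodicTrialState (m + 1) L) {c : ℂ} (hc : ‖c‖ = 1) {η ε : ℝ} (hη : 0 < η)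
    (hηε : 2 * η + η ^ 2 ≤ ε)
    (hclose : ∫⁻ X in cellN (m + 1) L, (‖Θ.ψ X - c * Ξ.ψ X‖₊ : ℝ≥0∞) ^ 2 ≤ ENNReal.ofReal (η ^ 2)) :
    (hiMass m L β Θ.ψ).toReal ≤ (hiMass m L β Ξ.ψ).toReal + ε ∧
      (hiMass m L β Ξ.ψ).toReal ≤ (hiMass m L β Θ.ψ).toReal + ε := by
  -- adapted from `hiMass_toReal_close_of_phaseClose` (…GDTransferSeededLocalConstancyInt.lean)
  have hε : 0 ≤ ε := le_trans (by positivity) hηε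
  obtain ⟨h₁, h₂⟩ := lawMass_close_of_sqClose hC m hL (fun j => (1 - β) * (m + 1) ≤ (j : ℝ)) Θ Ξ hc hη
    hclose
  have hfin : ∀ Λ : PeriodicTrialState (m + 1) L, hiMass m L β Λ.ψ ≠ ⊤ := fun Λ => by
    refine ne_top_of_le_ne_top ENNReal.one_ne_top ?_
    have h1 := (hC.1 m L hL Λ).1
    unfold hiMass lawMass
    rw [← h1]
    exact Finset.sum_le_sum_of_subset (Finset.filter_subset _ _)
  have hreal : ∀ Λ Λ' : PeriodicTrialState (m + 1) L,
      hiMass m L β Λ.ψ ≤ hiMass m L β Λ'.ψ + ENNReal.ofReal (2 * η + η ^ 2) →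
      (hiMass m L β Λ.ψ).toReal ≤ (hiMass m L β Λ'.ψ).toReal + ε := fun Λ Λ' h => by
    have h2 := ENNReal.toReal_mono (ENNReal.add_ne_top.2 ⟨hfin Λ', ENNReal.ofReal_ne_top⟩)
      (h.trans (add_le_add le_rfl (ENNReal.ofReal_le_ofReal hηε)))
    rwa [ENNReal.toReal_add (hfin Λ') ENNReal.ofReal_ne_top, ENNReal.toReal_ofReal hε] at h2
  exact ⟨hreal Θ Ξ h₁, hreal Ξ Θ h₂⟩

/-! ## The stub -/

/-- **Registered stub `stub_localConstancyL1`** (line `seeded-continuity`, skeleton v8, of crux `GDTransfer`,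
stmt-AtomisticToContinuum-9482): local constancy in the side `L` of the condensed-side mass of the
near-minimisers, for measurable repulsive finite-range profiles that are finite on `[0, ∞)` with integrable
radial lift, given the compactness transport (D) `DilateCompactL1` (near-minimisers of `b⁻²v(·/b)` are `L²`-close
to near-minimisers of `v`), the phase stability `NearMinPhaseInt` and the count law.  Dilation transport
(`PeriodicTrialState.dilate`, exact covariance `periodicEnergy_dilate` / `periodicGroundStateEnergy_scaledPotential`,
same law `hiMass_dilate`) + (D) + phase alignment at `(N, L₁)` + the `L²`-Lipschitz bound of the law.
[cite: LSSY2005, Ch. 5, footnote to (5.3)] -/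
theorem stub_localConstancyL1 : Sig.stub_localConstancyL1 := by
  intro hDil hPhase hC v hv hfin hint m β L₁ hL₁
  obtain ⟨R₀, hR₀⟩ := hv.2
  -- `E₀ < ∞` and the phase closeness of near-minimisers at `(N, L₁)`: the two halves of `NearMinPhaseInt`
  obtain ⟨hE₀fin, hph⟩ := hPhase v hv.1 R₀ hR₀ hint m L₁ hL₁
  refine ⟨hE₀fin, fun ε hε => ?_⟩
  -- the tolerance `η` with `2(2η) + (2η)² ≤ ε`
  set η : ℝ := min (ε / 16) (1 / 2) with hη
  have hη0 : 0 < η := lt_min (by positivity) one_half_pos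
  have hη2 : 0 < 2 * η := by positivity
  have hηε : 2 * (2 * η) + (2 * η) ^ 2 ≤ ε := by
    nlinarith [min_le_left (ε / 16) (1 / 2), min_le_right (ε / 16) (1 / 2),
      mul_nonneg hη0.le (sub_nonneg.2 (min_le_right (ε / 16) (1 / 2)))]
  -- the phase slack `δ₁` at `(N, L₁)` and the compactness transport (D) towards `δ₁`-near-minimisers
  obtain ⟨δ₁, hδ₁0, hδ₁⟩ := hph η hη0
  obtain ⟨ϑ, hϑ0, δD, hδD0, hD⟩ := hDil v hv hfin hint m L₁ hL₁ η hη0 δ₁ hδ₁0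
  -- the radius and the slack at `L₁`
  refine ⟨min (L₁ / 2) (ϑ * L₁ / 2), by positivity, δ₁, hδ₁0, fun L' hL' => ?_⟩
  have hr1 : |L' - L₁| < L₁ / 2 := hL'.trans_le (min_le_left _ _)
  have hr2 : |L' - L₁| < ϑ * L₁ / 2 := hL'.trans_le (min_le_right _ _)
  have hL'ge : L₁ / 2 < L' := by linarith [(abs_lt.1 hr1).1]
  have hL'pos : 0 < L' := by linarith
  set b : ℝ := L₁ / L' with hb
  have hb0 : 0 < b := div_pos hL₁ hL'pos
  have hbL : L₁ = b * L' := by rw [hb, div_mul_cancel₀ _ hL'pos.ne']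
  have hb1 : |b - 1| < ϑ := by
    rw [hb, show L₁ / L' - 1 = (L₁ - L') / L' by field_simp, abs_div, abs_of_pos hL'pos,
      div_lt_iff₀ hL'pos, abs_sub_comm]
    calc |L' - L₁| < ϑ * L₁ / 2 := hr2
      _ = ϑ * (L₁ / 2) := by ring
      _ ≤ ϑ * L' := by gcongr
  have hb2 : ENNReal.ofReal (b ^ 2) ≠ 0 := by simpa using hb0.ne'
  -- the slack at `L'`: `b² δ'_D`
  refine ⟨ENNReal.ofReal (b ^ 2) * δD, ENNReal.mul_pos hb2 hδD0.ne', fun Ψ' Ψ₁ hΨ' hΨ₁ => ?_⟩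
  -- the dilated state: same `hiMass`, `δ'_D`-near-minimiser of the scaled potential at side `L₁`
  set Φ : PeriodicTrialState (m + 1) L₁ := Ψ'.dilate b hb0 hbL with hΦ
  have hmass : hiMass m L₁ β Φ.ψ = hiMass m L' β Ψ'.ψ := hiMass_dilate hb0 hbL β Ψ'
  have hGS : periodicGroundStateEnergy (scaledPotential v b) (m + 1) L₁ =
      (ENNReal.ofReal (b ^ 2))⁻¹ * periodicGroundStateEnergy v (m + 1) L' := by
    have h := periodicGroundStateEnergy_scaledPotential (M := L') hb0 v (m + 1)
    rwa [← hbL] at h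
  have hΦsc : periodicEnergy (scaledPotential v b) Φ ≤
      periodicGroundStateEnergy (scaledPotential v b) (m + 1) L₁ + δD := by
    rw [hΦ, periodicEnergy_dilate hb0 hbL v Ψ', hGS]
    calc (ENNReal.ofReal (b ^ 2))⁻¹ * periodicEnergy v Ψ'
        ≤ (ENNReal.ofReal (b ^ 2))⁻¹ * (periodicGroundStateEnergy v (m + 1) L' +
            ENNReal.ofReal (b ^ 2) * δD) := by gcongr
      _ = (ENNReal.ofReal (b ^ 2))⁻¹ * periodicGroundStateEnergy v (m + 1) L' + δD := by
          rw [mul_add, ← mul_assoc, ENNReal.inv_mul_cancel hb2 ENNReal.ofReal_ne_top, one_mul]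
  -- (D): a `δ₁`-near-minimiser `Θ` of `v` at `(N, L₁)` within `η` of `Φ`
  obtain ⟨Θ, hΘnear, hΘclose⟩ := hD b hb0 hb1 Φ hΦsc
  -- phase alignment of the two `δ₁`-near-minimisers `Θ`, `Ψ₁` of `v` at `(N, L₁)`
  obtain ⟨c, hc, hcclose⟩ := hδ₁ Θ Ψ₁ hΘnear hΨ₁
  -- two `η`-steps: `Φ` is `2η`-close to `cΨ₁`
  have htri : ∫⁻ X in cellN (m + 1) L₁, (‖Φ.ψ X - c * Ψ₁.ψ X‖₊ : ℝ≥0∞) ^ 2 ≤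
      ENNReal.ofReal ((2 * η) ^ 2) :=
    lintegral_nnnorm_sub_sq_le_of_le_of_le Φ.contDiff.continuous.measurable
      Θ.contDiff.continuous.measurable hΘclose hcclose
  -- law comparison at `(N, L₁)` and transport of the law back to `L'`
  have h := hiMass_toReal_close_of_sqClose hC m hL₁ β Φ Ψ₁ hc hη2 hηε htri
  rwa [hmass] at h

end Summit.AtomisticToContinuum.BoseEinsteinCondensation.Cruxes.GDTransfer.Seeded

end
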